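import Literature.NumberTheory.Transcendental.RoySmallValueEstimatesEndgameProofs
import HarnessLib

/-!
# Roy's small value estimate for `𝔾ₐ × 𝔾ₘ` — the endgame (Step 5 of the proof of Theorem 1.1)

Topic `Literature/NumberTheory/Transcendental`. Part of the formalisation of the proof of Roy 2013,
Theorem 1.1 (named fact `roy2013_thm_1_1`, `RoySmallValueEstimates.lean`). Source: D. Roy,
*A small value estimate for `𝔾ₐ × 𝔾ₘ`*, Mathematika 59 (2013) 333–363 = arXiv:1301.0663, §7,
Step 5 (p. 19 of the arXiv text):

> Combining these three inequalities, we obtain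
> `−(D^δ/25)(D^β deg(Z) + D h(Z)) ≥ −(T/T* + 1)(8(D*)^β deg(Z) + D* h(Z))` and so
> `D^{δ+β} deg(Z) + D^{δ+1} h(Z) ≪ D^τ (D*)^{1−τ} h(Z)` [...]. This means that
> `D^{δ+β−τ} deg(Z) ≪ (D*)^{1−τ} h(Z)` and `(D*)^{τ−1} ≪ D^{τ−δ−1}`. Since `deg(Z) ≥ 1` and
> `h(Z) ≪ (D*)^{1+β−τ}` (see Step 3), the first estimate implies that
> `D^{δ+β−τ} ≪ (D*)^{β+2−2τ}`. As `τ ≥ 1`, combining this with the second estimate yields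
> `(τ−1)(δ+β−τ) ≤ (τ−δ−1)(β+2−2τ)` which after simplifications is equivalent to
> `δ ≤ (τ−1)(2−τ)/(β+1−τ)`. This contradicts the hypothesis on `ν`.

This file proves exactly this bookkeeping, in abstract form (all constants generic, `25 ↦ 1/κ`,
`8 ↦ A`, `7 ↦ A₃`), so that the assembly of Theorem 1.1 only has to deliver, for arbitrarily large
`D`, the level `D*`, the numbers `deg(Z) ≥ 1`, `h(Z) ≥ 0` and the combined inequality of Steps 2
and 4:

* `endgame_step` — from the combined inequality at one level `D` (with `T ≤ D^τ`,
  `(D*)^τ ≤ 2T*`, `1 ≤ D* ≤ D`, `κ D^δ ≥ 6A`, `h(Z) ≤ A₃ (D*)^{1+β−τ}`): `h(Z) > 0`,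
  `(D*)^{τ−1} ≤ (3/κ) D^{τ−1−δ}` and `D^{δ+β−τ} ≤ (6A₃/κ)(D*)^{β+2−2τ}`;
* `exponent_contradiction` — these two estimates cannot hold for arbitrarily large `D` when
  `1 ≤ τ < 2`, `τ < β` and `δ > (τ−1)(2−τ)/(β+1−τ)`, `δ > 0`;
* `endgame` — the combination.

Everything is proved (real analysis only); no definitions, no named facts.

## References

* [Roy2013] D. Roy, *A small value estimate for 𝔾ₐ × 𝔾ₘ*, Mathematika 59 (2013), 333–363
  (arXiv:1301.0663), §7, Step 5.
-/

noncomputable section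

open Filter Real

namespace Literature.NumberTheory.Transcendental

namespace Roy2013

/-! ### The exponent bookkeeping -/

/-- **Roy 2013, §7, end of Step 5.** If `1 ≤ τ`, `τ < β`, `δ > 0` and
`δ > (τ−1)(2−τ)/(β+1−τ)`, it is impossible that for arbitrarily large `D ≥ 1` there is `D* ≥ 1`
with `D^{δ+β−τ} ≤ A (D*)^{β+2−2τ}` and `(D*)^{τ−1} ≤ B D^{τ−1−δ}`.
[cite: Roy2013, §7, Step 5] -/
theorem exponent_contradiction {τ β δ A B : ℝ} (hτ1 : 1 ≤ τ) (hβ : τ < β) (hδ0 : 0 < δ)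
    (hδ : (τ - 1) * (2 - τ) / (β + 1 - τ) < δ) (hA : 0 < A) (hB : 0 < B)
    (h : ∀ N : ℝ, ∃ D : ℝ, N ≤ D ∧ 1 ≤ D ∧ ∃ Ds : ℝ, 1 ≤ Ds ∧
      D ^ (δ + β - τ) ≤ A * Ds ^ (β + 2 - 2 * τ) ∧ Ds ^ (τ - 1) ≤ B * D ^ (τ - 1 - δ)) :
    False := by
  have hβ1 : 0 < β + 1 - τ := by linarith
  rcases eq_or_lt_of_le hτ1 with hτeq | hτgt
  · -- `τ = 1`: the second estimate reads `1 ≤ B D^{−δ}`, i.e. `D^δ ≤ B`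
    have key : δ ≤ 0 := by
      refine NguyenRoy.le_of_frequently_rpow_le (K := B) fun N => ?_
      obtain ⟨D, hD, hD1, Ds, hDs, -, h2⟩ := h N
      refine ⟨D, hD, ?_⟩
      have hDpos : 0 < D := by linarith
      rw [← hτeq, sub_self, Real.rpow_zero, zero_sub, Real.rpow_neg hDpos.le] at h2
      rw [Real.rpow_zero, mul_one]
      have h3 : 0 < D ^ δ := Real.rpow_pos_of_pos hDpos δ
      have h4 : 1 * D ^ δ ≤ B * (D ^ δ)⁻¹ * D ^ δ := mul_le_mul_of_nonneg_right h2 h3.le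
      rwa [one_mul, mul_assoc, inv_mul_cancel₀ h3.ne', mul_one] at h4
    linarith
  · have hs : 0 < τ - 1 := by linarith
    by_cases hE : β + 2 - 2 * τ ≤ 0
    · -- `(D*)^{β+2−2τ} ≤ 1`, so `D^{δ+β−τ} ≤ A`
      have key : δ + β - τ ≤ 0 := by
        refine NguyenRoy.le_of_frequently_rpow_le (K := A) fun N => ?_
        obtain ⟨D, hD, hD1, Ds, hDs, h1, -⟩ := h N
        refine ⟨D, hD, ?_⟩
        rw [Real.rpow_zero, mul_one]
        refine h1.trans (mul_le_of_le_one_right hA.le ?_)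
        exact Real.rpow_le_one_of_one_le_of_nonpos hDs hE
      linarith
    · push Not at hE
      set q : ℝ := (β + 2 - 2 * τ) / (τ - 1) with hq
      have hq0 : 0 < q := div_pos hE hs
      have hsq : (τ - 1) * q = β + 2 - 2 * τ := by rw [hq]; field_simp
      have key : δ + β - τ ≤ (τ - 1 - δ) * q := by
        refine NguyenRoy.le_of_frequently_rpow_le (K := A * B ^ q) fun N => ?_
        obtain ⟨D, hD, hD1, Ds, hDs, h1, h2⟩ := h N
        refine ⟨D, hD, ?_⟩
        have hDpos : 0 < D := by linarith
        have hDs0 : (0 : ℝ) ≤ Ds := by linarith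
        have e1 : Ds ^ (β + 2 - 2 * τ) = (Ds ^ (τ - 1)) ^ q := by
          rw [← Real.rpow_mul hDs0, hsq]
        have e2 : (Ds ^ (τ - 1)) ^ q ≤ (B * D ^ (τ - 1 - δ)) ^ q :=
          Real.rpow_le_rpow (Real.rpow_nonneg hDs0 _) h2 hq0.le
        have e3 : (B * D ^ (τ - 1 - δ)) ^ q = B ^ q * D ^ ((τ - 1 - δ) * q) := by
          rw [Real.mul_rpow hB.le (Real.rpow_nonneg hDpos.le _), ← Real.rpow_mul hDpos.le]
        calc D ^ (δ + β - τ) ≤ A * Ds ^ (β + 2 - 2 * τ) := h1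
          _ ≤ A * (B ^ q * D ^ ((τ - 1 - δ) * q)) := by
              rw [e1]
              exact mul_le_mul_of_nonneg_left (e2.trans_eq e3) hA.le
          _ = A * B ^ q * D ^ ((τ - 1 - δ) * q) := by ring
      have key' : (τ - 1) * (δ + β - τ) ≤ (τ - 1 - δ) * ((τ - 1) * q) := by
        have := mul_le_mul_of_nonneg_left key hs.le
        linarith [this]
      rw [hsq] at key'
      rw [div_lt_iff₀ hβ1] at hδ
      have hid : (τ - 1 - δ) * (β + 2 - 2 * τ) - (τ - 1) * (δ + β - τ) =
          (τ - 1) * (2 - τ) - δ * (β + 1 - τ) := by ring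
      linarith

/-! ### From the combined inequality of Steps 2 and 4 to the two estimates -/

/-- **Roy 2013, §7, Step 5, first half.** From
`κ D^δ (D^β d + D h) ≤ (T/T* + 1)(A (D*)^β d + D* h)` with `T ≤ D^τ`, `(D*)^τ ≤ 2T*`,
`1 ≤ D* ≤ D`, `d ≥ 1`, `0 ≤ h ≤ A₃ (D*)^{1+β−τ}` and `κ D^δ ≥ 6A`: `(D*)^{τ−1} ≤ (3/κ) D^{τ−1−δ}`
and `D^{δ+β−τ} ≤ (6A₃/κ)(D*)^{β+2−2τ}`. [cite: Roy2013, §7, Step 5] -/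
theorem endgame_step {τ β δ κ A A₃ D Ds d h T Ts : ℝ} (hτ0 : 0 ≤ τ) (hβ : τ ≤ β)
    (hκ : 0 < κ) (hD : 1 ≤ D) (hDs1 : 1 ≤ Ds) (hDsD : Ds ≤ D) (hd : 1 ≤ d) (hh0 : 0 ≤ h)
    (hh : h ≤ A₃ * Ds ^ (1 + β - τ)) (hT0 : 0 ≤ T) (hT : T ≤ D ^ τ) (hTs : 0 < Ts)
    (hTs2 : Ds ^ τ ≤ 2 * Ts) (hlarge : 6 * A ≤ κ * D ^ δ)
    (hineq : κ * D ^ δ * (D ^ β * d + D * h) ≤ (T / Ts + 1) * (A * Ds ^ β * d + Ds * h)) :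
    Ds ^ (τ - 1) ≤ 3 / κ * D ^ (τ - 1 - δ) ∧
      D ^ (δ + β - τ) ≤ 6 * A₃ / κ * Ds ^ (β + 2 - 2 * τ) := by
  have hDpos : 0 < D := by linarith
  have hDs0 : 0 < Ds := by linarith
  have hDτ : 0 < D ^ τ := Real.rpow_pos_of_pos hDpos τ
  have hDsτ : 0 < Ds ^ τ := Real.rpow_pos_of_pos hDs0 τ
  have hDδ : 0 < D ^ δ := Real.rpow_pos_of_pos hDpos δ
  have hDβ : 0 < D ^ β := Real.rpow_pos_of_pos hDpos β
  -- `T/T* + 1 ≤ 3 D^τ / (D*)^τ`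
  set X : ℝ := D ^ τ / Ds ^ τ with hX
  have hX1 : 1 ≤ X := by
    rw [hX, one_le_div hDsτ]
    exact Real.rpow_le_rpow hDs0.le hDsD hτ0
  have hratio : T / Ts + 1 ≤ 3 * X := by
    have h1 : T / Ts ≤ D ^ τ / Ts := div_le_div_of_nonneg_right hT hTs.le
    have h2 : D ^ τ / Ts ≤ D ^ τ / (Ds ^ τ / 2) :=
      div_le_div_of_nonneg_left hDτ.le (by positivity) (by linarith)
    have h3 : D ^ τ / (Ds ^ τ / 2) = 2 * X := by rw [hX]; field_simp
    linarith
  -- rewrite the right-hand side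
  have hR0 : 0 ≤ A * Ds ^ β * d + Ds * h := by
    have hlargeA : 6 * A ≤ κ * D ^ δ := hlarge
    -- `A` may be of any sign in principle; but if `A < 0` the estimate below only improves.
    -- We only need an upper bound, obtained via `hratio` when the bracket is nonnegative,
    -- and trivially otherwise; handle both at once further down.
    by_cases hbr : 0 ≤ A * Ds ^ β * d + Ds * h
    · exact hbr
    · exfalso
      -- then the RHS of `hineq` is `< 0` unless `T/Ts + 1 ≤ 0`, impossible; the LHS is `≥ 0`
      have hpos : 0 < T / Ts + 1 := by positivity
      have hlhs : 0 ≤ κ * D ^ δ * (D ^ β * d + D * h) := by positivity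
      have : (T / Ts + 1) * (A * Ds ^ β * d + Ds * h) < 0 := mul_neg_of_pos_of_neg hpos (by linarith)
      linarith
  have hXβ : X * Ds ^ β = D ^ τ * Ds ^ (β - τ) := by
    rw [hX, Real.rpow_sub hDs0, div_mul_eq_mul_div, mul_div_assoc]
  have hX1' : X * Ds = D ^ τ * Ds ^ (1 - τ) := by
    rw [hX, Real.rpow_sub hDs0, Real.rpow_one, div_mul_eq_mul_div, mul_div_assoc]
  have hstep1 : κ * D ^ δ * (D ^ β * d + D * h) ≤
      3 * A * (D ^ τ * Ds ^ (β - τ)) * d + 3 * (D ^ τ * Ds ^ (1 - τ)) * h := by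
    calc κ * D ^ δ * (D ^ β * d + D * h) ≤ (T / Ts + 1) * (A * Ds ^ β * d + Ds * h) := hineq
      _ ≤ 3 * X * (A * Ds ^ β * d + Ds * h) := mul_le_mul_of_nonneg_right hratio hR0
      _ = 3 * A * (X * Ds ^ β) * d + 3 * (X * Ds) * h := by ring
      _ = _ := by rw [hXβ, hX1']
  -- first term: `3A D^τ (D*)^{β−τ} d ≤ 3A D^β d ≤ (κ/2) D^δ D^β d`
  have hDsβτ : Ds ^ (β - τ) ≤ D ^ (β - τ) := Real.rpow_le_rpow hDs0.le hDsD (by linarith)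
  have hDτβ : D ^ τ * D ^ (β - τ) = D ^ β := by
    rw [← Real.rpow_add hDpos]; ring_nf
  have hterm1 : 3 * A * (D ^ τ * Ds ^ (β - τ)) * d ≤ κ / 2 * D ^ δ * D ^ β * d := by
    have hA3 : 3 * A ≤ κ / 2 * D ^ δ := by linarith
    by_cases hA0 : 0 ≤ A
    · calc 3 * A * (D ^ τ * Ds ^ (β - τ)) * d ≤ 3 * A * (D ^ τ * D ^ (β - τ)) * d := by
            gcongr
        _ = 3 * A * D ^ β * d := by rw [hDτβ]
        _ ≤ κ / 2 * D ^ δ * D ^ β * d := by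
            have : 0 ≤ D ^ β * d := by positivity
            nlinarith
    · push Not at hA0
      have h1 : 3 * A * (D ^ τ * Ds ^ (β - τ)) * d ≤ 0 := by
        have : 0 ≤ (D ^ τ * Ds ^ (β - τ)) * d := by positivity
        nlinarith
      have h2 : 0 ≤ κ / 2 * D ^ δ * D ^ β * d := by positivity
      linarith
  -- (*) : `(κ/2) D^δ D^β d + κ D^δ D h ≤ 3 D^τ (D*)^{1−τ} h`
  have hstar : κ / 2 * D ^ δ * D ^ β * d + κ * D ^ δ * D * h ≤ 3 * (D ^ τ * Ds ^ (1 - τ)) * h := by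
    nlinarith [hstep1, hterm1]
  -- `h > 0`
  have hDs1τ : 0 < Ds ^ (1 - τ) := Real.rpow_pos_of_pos hDs0 _
  have hhpos : 0 < h := by
    rcases eq_or_lt_of_le hh0 with h0 | hpos
    · exfalso
      rw [← h0, mul_zero, mul_zero, add_zero] at hstar
      have : 0 < κ / 2 * D ^ δ * D ^ β * d := by positivity
      linarith
    · exact hpos
  constructor
  · -- (ii): `κ D^δ D ≤ 3 D^τ (D*)^{1−τ}`, then multiply by `(D*)^{τ−1}`
    have h1 : κ * D ^ δ * D * h ≤ 3 * (D ^ τ * Ds ^ (1 - τ)) * h := by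
      have : 0 ≤ κ / 2 * D ^ δ * D ^ β * d := by positivity
      linarith
    have h2 : κ * D ^ δ * D ≤ 3 * (D ^ τ * Ds ^ (1 - τ)) := le_of_mul_le_mul_right h1 hhpos
    have hcancel : Ds ^ (τ - 1) * Ds ^ (1 - τ) = 1 := by
      rw [← Real.rpow_add hDs0]; ring_nf; exact Real.rpow_zero Ds
    have h3 : Ds ^ (τ - 1) * (κ * D ^ δ * D) ≤ 3 * D ^ τ := by
      calc Ds ^ (τ - 1) * (κ * D ^ δ * D) ≤ Ds ^ (τ - 1) * (3 * (D ^ τ * Ds ^ (1 - τ))) :=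
            mul_le_mul_of_nonneg_left h2 (Real.rpow_nonneg hDs0.le _)
        _ = 3 * D ^ τ * (Ds ^ (τ - 1) * Ds ^ (1 - τ)) := by ring
        _ = 3 * D ^ τ := by rw [hcancel, mul_one]
    have hDpow : D ^ δ * D = D ^ (δ + 1) := by
      rw [Real.rpow_add hDpos, Real.rpow_one]
    have hDpow2 : D ^ (τ - 1 - δ) * D ^ (δ + 1) = D ^ τ := by
      rw [← Real.rpow_add hDpos]; ring_nf
    have hDδ1 : 0 < D ^ (δ + 1) := Real.rpow_pos_of_pos hDpos _
    rw [mul_assoc κ, hDpow] at h3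
    -- `Ds^{τ−1} κ D^{δ+1} ≤ 3 D^τ = 3 D^{τ−1−δ} D^{δ+1}`
    rw [← hDpow2] at h3
    have h4 : Ds ^ (τ - 1) * κ ≤ 3 * D ^ (τ - 1 - δ) := by
      have := le_of_mul_le_mul_right (by linarith [h3] : Ds ^ (τ - 1) * κ * D ^ (δ + 1) ≤
        3 * D ^ (τ - 1 - δ) * D ^ (δ + 1)) hDδ1
      exact this
    rw [show 3 / κ * D ^ (τ - 1 - δ) = 3 * D ^ (τ - 1 - δ) / κ by ring, le_div_iff₀ hκ]
    exact h4
  · -- (i): `(κ/2) D^δ D^β d ≤ 3 D^τ (D*)^{1−τ} h ≤ 3A₃ D^τ (D*)^{β+2−2τ}`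
    have h1 : κ / 2 * D ^ δ * D ^ β * d ≤ 3 * (D ^ τ * Ds ^ (1 - τ)) * h := by
      have : 0 ≤ κ * D ^ δ * D * h := by positivity
      linarith
    have h2 : 3 * (D ^ τ * Ds ^ (1 - τ)) * h ≤ 3 * A₃ * D ^ τ * Ds ^ (β + 2 - 2 * τ) := by
      have hpow : Ds ^ (1 - τ) * Ds ^ (1 + β - τ) = Ds ^ (β + 2 - 2 * τ) := by
        rw [← Real.rpow_add hDs0]; ring_nf
      calc 3 * (D ^ τ * Ds ^ (1 - τ)) * h ≤ 3 * (D ^ τ * Ds ^ (1 - τ)) * (A₃ * Ds ^ (1 + β - τ)) :=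
            mul_le_mul_of_nonneg_left hh (by positivity)
        _ = 3 * A₃ * D ^ τ * (Ds ^ (1 - τ) * Ds ^ (1 + β - τ)) := by ring
        _ = 3 * A₃ * D ^ τ * Ds ^ (β + 2 - 2 * τ) := by rw [hpow]
    have h3 : κ / 2 * D ^ δ * D ^ β ≤ 3 * A₃ * D ^ τ * Ds ^ (β + 2 - 2 * τ) := by
      have h4 : κ / 2 * D ^ δ * D ^ β ≤ κ / 2 * D ^ δ * D ^ β * d :=
        le_mul_of_one_le_right (by positivity) hd
      linarith
    have hDpow : D ^ (δ + β - τ) * D ^ τ = D ^ δ * D ^ β := by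
      rw [← Real.rpow_add hDpos, ← Real.rpow_add hDpos]; ring_nf
    have h5 : D ^ (δ + β - τ) * D ^ τ * (κ / 2) ≤ 3 * A₃ * Ds ^ (β + 2 - 2 * τ) * D ^ τ := by
      rw [hDpow]; linarith
    have h6 : D ^ (δ + β - τ) * (κ / 2) ≤ 3 * A₃ * Ds ^ (β + 2 - 2 * τ) :=
      le_of_mul_le_mul_right (by linarith [h5] : D ^ (δ + β - τ) * (κ / 2) * D ^ τ ≤
        3 * A₃ * Ds ^ (β + 2 - 2 * τ) * D ^ τ) hDτ
    rw [show 6 * A₃ / κ * Ds ^ (β + 2 - 2 * τ) = (3 * A₃ * Ds ^ (β + 2 - 2 * τ)) / (κ / 2) by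
      field_simp; ring]
    rw [le_div_iff₀ (by positivity)]
    exact h6

/-! ### The endgame -/

/-- **Roy 2013, §7, Step 5.** Under the constraints of Theorem 1.1 (`1 ≤ τ < 2`, `τ < β`,
`ν = 2 + β − τ + δ` with `δ > (τ−1)(2−τ)/(β+1−τ)`, `δ > 0`), it is impossible that for arbitrarily
large `D` one has a level `D* ≤ D` (with `D*` also large), a "degree" `d ≥ 1`, a "height"
`0 ≤ h ≤ A₃ (D*)^{1+β−τ}`, and `T ≤ D^τ`, `T* ≥ (D*)^τ/2 > 0`, satisfying the combined
inequality `κ D^δ (D^β d + D h) ≤ (T/T* + 1)(A (D*)^β d + D* h)` of Steps 2 and 4.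
[cite: Roy2013, §7, Step 5] -/
theorem endgame {τ β δ κ A A₃ : ℝ} (hτ1 : 1 ≤ τ) (hβ : τ < β) (hδ0 : 0 < δ)
    (hδ : (τ - 1) * (2 - τ) / (β + 1 - τ) < δ) (hκ : 0 < κ) (hA : 0 < A) (hA₃ : 0 < A₃)
    (h : ∀ N : ℝ, ∃ D : ℝ, N ≤ D ∧ ∃ Ds d hZ T Ts : ℝ, 1 ≤ Ds ∧ Ds ≤ D ∧ 1 ≤ d ∧ 0 ≤ hZ ∧
      hZ ≤ A₃ * Ds ^ (1 + β - τ) ∧ 0 ≤ T ∧ T ≤ D ^ τ ∧ 0 < Ts ∧ Ds ^ τ ≤ 2 * Ts ∧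
      κ * D ^ δ * (D ^ β * d + D * hZ) ≤ (T / Ts + 1) * (A * Ds ^ β * d + Ds * hZ)) : False := by
  -- the threshold beyond which `κ D^δ ≥ 6A`
  set N₀ : ℝ := (6 * A / κ) ^ δ⁻¹ with hN₀
  have hN₀0 : 0 ≤ N₀ := Real.rpow_nonneg (by positivity) _
  refine exponent_contradiction hτ1 hβ hδ0 hδ (A := 6 * A₃ / κ) (B := 3 / κ) (by positivity)
    (by positivity) fun N => ?_
  obtain ⟨D, hD, Ds, d, hZ, T, Ts, hDs1, hDsD, hd, hhZ0, hhZ, hT0, hT, hTs, hTs2, hineq⟩ :=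
    h (max N (max 1 N₀))
  have hD1 : 1 ≤ D := le_trans (le_trans (le_max_left _ _) (le_max_right _ _)) hD
  have hDN₀ : N₀ ≤ D := le_trans (le_trans (le_max_right _ _) (le_max_right _ _)) hD
  have hlarge : 6 * A ≤ κ * D ^ δ := by
    have h1 : N₀ ^ δ ≤ D ^ δ := Real.rpow_le_rpow hN₀0 hDN₀ hδ0.le
    rw [hN₀, Real.rpow_inv_rpow (by positivity) hδ0.ne'] at h1
    rw [div_le_iff₀ hκ] at h1
    linarith
  obtain ⟨h1, h2⟩ := endgame_step (by linarith) hβ.le hκ hD1 hDs1 hDsD hd hhZ0 hhZ hT0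
    hT hTs hTs2 hlarge hineq
  exact ⟨D, le_trans (le_max_left _ _) hD, hD1, Ds, hDs1, h2, h1⟩

end Roy2013

end Literature.NumberTheory.Transcendental
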